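import Mathlib

/-!
# Homogeneous components of a product with a homogeneous factor

A Mathlib-level lemma for `SmallCaseThreeFive` (stmt-ValiantsHypothesis-5644), line `Sketch`:
if `ψ` is homogeneous of degree `d`, then the degree-`(n + d)` homogeneous component of `φ * ψ`
is `homogeneousComponent n φ * ψ`.  This is the graded-ring identity
`DirectSum.coe_decompose_mul_add_of_right_mem` for the grading of `MvPolynomial σ R` by total
degree (`MvPolynomial.gradedAlgebra`, used only inside the proof), transported along
`MvPolynomial.decomposition.decompose'_apply`.
-/

noncomputable section
set_option linter.dupNamespace false

namespace Summit.ValiantsHypothesis.ValiantsHypothesis.Theorems.RefutationDegreeSmallCaseThreeFive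

open MvPolynomial

/-- If `ψ` is homogeneous of degree `d`, then the degree-`(n + d)` homogeneous component of
`φ * ψ` is `homogeneousComponent n φ * ψ`. -/
theorem stub_homogeneousComponent_mul {σ : Type*} {R : Type*} [CommSemiring R]
    (φ ψ : MvPolynomial σ R) {d : ℕ} (hψ : ψ.IsHomogeneous d) (n : ℕ) :
    homogeneousComponent (n + d) (φ * ψ) = homogeneousComponent n φ * ψ := by
  letI : GradedAlgebra (homogeneousSubmodule σ R) := MvPolynomial.gradedAlgebra
  -- the degree-`i` piece of `DirectSum.decompose` is the `i`-th homogeneous component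
  have key : ∀ (χ : MvPolynomial σ R) (i : ℕ),
      ((DirectSum.decompose (homogeneousSubmodule σ R) χ i : homogeneousSubmodule σ R i) :
        MvPolynomial σ R) = homogeneousComponent i χ :=
    fun χ i => MvPolynomial.decomposition.decompose'_apply χ i
  have h := DirectSum.coe_decompose_mul_add_of_right_mem (homogeneousSubmodule σ R)
    (a := φ) (i := n) (j := d) hψ
  simpa only [key] using h

end Summit.ValiantsHypothesis.ValiantsHypothesis.Theorems.RefutationDegreeSmallCaseThreeFive

end
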